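import Summits.BirchSwinnertonDyer.BirchSwinnertonDyer.Theorems.KatoDescentPotSupersingularUnitIndexMuDoorsFukudaAt
import Summits.BirchSwinnertonDyer.BirchSwinnertonDyer.Theorems.KatoDescentPotSupersingularWildUpperUnitTwistRecordsClassO617
import Summits.BirchSwinnertonDyer.BirchSwinnertonDyer.Theorems.KatoDescentPotSupersingularWildUpperUnitTwistRecordsClassO618
import HarnessLib

/-!
# Route `KatoDescentPotSupersingular` (rung K9, sub-rung B5 = O6 wild `p = 3`, cell `bsd-potss`): per-row U₀ RECORDS on the `GL₂(𝔽₃)`-image (9-deficient) U₀-ns rows BY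
# FUKUDA'S LAYER CRITERION AT `(0,1)` ON THE UNIPOTENT-STABILISER FIELD `L_P = ℚ(E[3])^{U_P} = ℚ(P, ζ₃)` (degree 16) — a SECOND road beside the unit-twist records on rows
# with NO Cartan road (`3 ∣ #GL₂(𝔽₃)`), part 02: 388800ha1, 388800hb1, 388800hc1, 388800hp1, 388800hv1
# (seat `bsd-potss-k9-c4` g23; door = k9-c4 g19's `UnitIndexMuDoors.missingUpperBoundAt_three_of_classNumberPExp_succ_eqAt_unipotentStabilizerField` (p635084) at `n = 0`;
# record shape = k9-c4 g21's `…WildConjAResidueUnitIndexRows06` (`_lp12`, 388800ho1) verbatim with `n = 0`; numerics = conjA-anchor g9's kit j296187 (`lp16.gp`);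
# `--supports stmt-BirchSwinnertonDyer-19197 --as helper`)

HONEST FRAMING. THEOREMS ONLY (no definition, no named fact, no `sorry`); PER ROW — NOT a class theorem; nothing booked; items 19189 / 19197 (and the aside 19386,
whose stub `surjModThree` these rows populate) stay OPEN at class level (open non-held input of the U₀ cone: the zeta crux 24327); (A), Conjecture A and BSD are
proved for NO curve here.  CONDITIONAL on the named facts displayed as hypotheses (Lim 2017 Thm. 3.5 `hLim`, Fukuda 1994 Thm. 1 (1) `hF1`; for U₀ also Kato's
A161-fine `hKatoA`, GZK `hGZK`, modularity `hmod`) and on two displayed NUMERIC hypotheses about ONE explicit number field per row, `L_P = ℚ(E[3])^{U_P}` for a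
`3`-torsion point `P` (conjA-anchor g9, `Literature/…/DivisionFieldUnipotentStabilizer.lean`: the image of `U_P` is a `3`-group, so Lim's index hypothesis is
structural; `L_P = ℚ(P, ζ₃)` by the Weil pairing on the certificate side):
* `hram` — Fukuda's index is `0` on `L_P`: every prime of `L_P` above `3` is totally ramified in the first cyclotomic layer.  EVIDENCE (kit j296187, EXACT): the
  ramification indices of the primes above `3` of `k = ℚ(x(P))` are all multiplied by `3` in `k₁ = k·ℚ(ζ₉)⁺` (column TOTRAM), and `[L_P : k] = 4` is prime to `3`;
* `hord` — `e₁(L_P) = e₀(L_P)`.  EVIDENCE (kit j296187): `e₀(L_P) = ord₃ h(L_P)` from `bnfinit` + `bnfcertify` on the degree-16 field (CERTIFIED on every row below);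
  `e₁(L_P)` is NOT read off the degree-48 layer but through Kuroda's relation for the `V₄`-extension `L_{P,1}/k₁` (tree theorem
  `IwasawaTheory.classNumberPExp_biquadratic_relation`, conjA-anchor g11; exact on `3`-parts for odd `p`): `e(L_{P,n}) + 2·e(k_n) = e(O_{1,n}) + e(O_{2,n}) + e(O_{3,n})`
  over the three octics `O₁ = ℚ(P)`, `O₂ = k(ζ₃)`, `O₃` between `k` and `L_P` (checked at layer 0 on every row: column KURODA-OK), with `h(O_{i,1})` of the three
  degree-24 layers under GRH — so GRH enters ONLY through `e₁`.
Then Fukuda 1994 Thm. 1 (1) (`n₀ = 0`) gives `e_n(L_P) = e₀(L_P)` for all `n`, i.e. `μ(L_P,cyc) = 0` (and `λ = 0`), Lim 2017 Thm. 3.5 + Lemma 3.2 give Conjecture A for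
`E` at `3` over `ℚ_cyc`, and Kato 14.5 (3) / 12.5 (3) (A161-fine) + GZK + modularity give U₀.  KERNEL row certificates (imported): `Δ ≠ 0`, global minimality,
`E[3]` irreducible (`irr_g…_3`), `ClassO6 E 3` (`classO6_g…_3`).  The `GL₂(𝔽₃)` rows on which `e₁(L_P) > e₀(L_P)` (7776f1, 194400cn1, 388800hd1, 388800ij1, 470448dq1;
388800ho1 = k9-c4 g21 `_lp12`) are NOT recorded here.

References: [Lim2017FineSelmer] §3 Thm. 3.5, Lemma 3.2; [Fukuda1994] Thm. 1 (1); [Lemmermeyer1994] §1 (Kuroda); [Kato2004Asterisque] Thm. 14.5 (3), 12.5 (3);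
[CoatesSujatha2005] Thm. 3.4; [Serre1972] §IV; [Cremona2006] Table 1.
-/

set_option linter.dupNamespace false
set_option autoImplicit false

noncomputable section

open scoped Classical NumberField
open WeierstrassCurve NumberField IsDedekindDomain Field IntermediateField
  Literature.NumberTheory.EllipticCurves Literature.NumberTheory.EllipticCurves.Rank1Residual
  Literature.NumberTheory.EllipticCurves.Rank1Residual.Typed
  Literature.NumberTheory.GaloisRepresentations Literature.NumberTheory.SerreUniformity Literature.NumberTheory.IwasawaTheory
  Summit.BirchSwinnertonDyer.Rank1Residual Summit.BirchSwinnertonDyer.Rank1Residual.Additive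
  Summit.BirchSwinnertonDyer.BirchSwinnertonDyer.Theorems

namespace Summit.BirchSwinnertonDyer.BirchSwinnertonDyer.Theorems.WildUpperUnitTwistRecords

/-! ### `388800ha1` @ `p = 3` — `N = 388800 = 2^6·3^5·5^2`; Cremona: `r_an = 0`; O6 wild at `3`; mod-`3` image `GL₂(𝔽₃)` (9-deficient tower; NO Cartan road); first road: the unit-twist record
`missingUpperBoundAt_g388800ha1_3` (k9-c4 g16/g17); kernel lemmas in `…WildUpperUnitTwistRecordsClassO617` (`classO6`) / `…WildUpperUnitTwistRecordsSharpP25` (`irr`, `isElliptic`, `isGloballyMinimal`).  conjA-anchor g9 kit j296187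
(`lp16.gp`): `k = ℚ(x(P)) = ℚ[x]/(x^4-6*x^2-7*x-3)` (`h = 1`), `K = ℚ(P) = ℚ[x]/(x^8-360*x^4+3720*x^2-10800)` (`h = 2`), `L_P = ℚ(P, ζ₃) = ℚ[x]/(x^16-120*x^12-1040*x^10+15600*x^8-81600*x^6+894400*x^4-2064000*x^2+1440000)` (degree 16): `h(L_P) = 12`
(`Cl ≅ [6, 2]`, CERTIFIED), primes above `3`: `4[[6,1],[2,1],[2,1],[6,1]]`; octic leaves `O1:h=2:CERT;O2:h=6:CERT;O3:h=2:CERT;O1,1:h=2:GRH;O2,1:h=6:GRH;O3,1:h=2:GRH`; `layer0; #octics>k 3 of 3 octic subfields; v3h(L_P)+2v3h(k) 1; sum v3h(O_i) 1; KURODA-OK; octics certified 1; k cert CERT`; layer `(0,1)`: TOTRAM, `e₀(L_P) = 1`, `e₁(L_P) = 1` (Kuroda, GRH),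
`r₀ = 1`, `r₁ = 1` ⟹ verdict FUKUDA1-LP(0,1). -/

/-- **(A) AT `(388800ha1, 3)` with the `μ`-hypothesis DISCHARGED by FUKUDA Thm. 1 (1) at layers `(0,1)` on `L_P = ℚ(E[3])^{U_P}`** (modulo the named facts
Lim 2017 Thm. 3.5 `hLim` and Fukuda `hF1`): `P` any geometric `3`-torsion point, displayed numerics on `L_P`: Fukuda index `0` (`hram`, exact: kit j296187 TOTRAM) and
`e₁(L_P) = e₀(L_P) = 1` (`hord`; `h(L_P) = 12` CERTIFIED, `e₁` by Kuroda from three degree-24 octic layers under GRH, kit j296187). CONDITIONAL; nothing booked;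
(A)/BSD proved for no curve. [cite: Lim2017FineSelmer, §3 Thm. 3.5 and Lemma 3.2 (arXiv:1306.2047 pp. 6–7)] [cite: Fukuda1994, Thm. 1 (1), p. 264] [cite: Cremona2006, Table 1 (Cremona label 388800ha1)] -/
theorem conjA_g388800ha1_3_lp01
    (hLim : Lim2017.thm35_fineSelmerDual_moduleFinite_of_classicalMuVanishes_of_le_divisionField)
    (hF1 : fukuda1994_thm1_classNumberPExp_const_of_succ_eq)
    {W : WeierstrassCurve ℚ} [W.IsElliptic] (hWeq : W = (⟨0, 0, 0, (-4860), (-130410)⟩ : WeierstrassCurve ℚ)) (P : W.geomTorsion (3 : ℕ))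
    (hram : ∀ κ : ZpExtension ↥(W.unipotentStabilizerField 3 P) 3, κ.IsCyclotomic → TotallyRamifiedFrom κ 0)
    (hord : ∀ κ : ZpExtension ↥(W.unipotentStabilizerField 3 P) 3, κ.IsCyclotomic →
      classNumberPExp κ (0 + 1) = classNumberPExp κ 0)
    (κ : ZpExtension ℚ 3) (hκ : κ.IsCyclotomic) :
    ∃ (γ : absoluteGaloisGroup ℚ) (Df : W.FineSelmerDualData κ γ),
      Module.Finite ℤ_[3] (RestrictScalars ℤ_[3] (IwasawaAlgebra 3) Df.X) := by
  subst hWeq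
  haveI : Fact (Nat.Prime 3) := ⟨Nat.prime_three⟩
  exact Lim2017.fineSelmerDual_moduleFinite_of_classNumberPExp_succ_eq_unipotentStabilizerField hF1 hLim _ 3 (by decide) 0 P hram hord κ hκ

/-- **RECORD (second road) — U₀ `ord₃ #Ш(E) ≤ ord₃ #Ш_an(E)` for `E = 388800ha1` with the `μ`-hypothesis DISCHARGED by FUKUDA Thm. 1 (1) at layers `(0,1)` on `L_P`**: named facts
{A161-fine `hKatoA`, GZK `hGZK`, modularity `hmod`, `hLim`, `hF1`}, Cremona's `r_an = 0` (`hr`), a `3`-torsion point `P` and the displayed numerics `hram` / `hord` of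
`L_P = ℚ(E[3])^{U_P}` (evidence: conjA-anchor g9 kit j296187; GRH through the degree-24 octic layers only). KERNEL: `E` elliptic, minimal, `ClassO6 E 3`, `E[3]` irreducible.
Per row; nothing booked; BSD proved for no curve. [cite: Kato2004Asterisque, Thm. 14.5 (3) (p. 236)] [cite: Lim2017FineSelmer, §3 Thm. 3.5 and Lemma 3.2 (arXiv:1306.2047 pp. 6–7)]
[cite: Fukuda1994, Thm. 1 (1), p. 264] [cite: Cremona2006, Table 1 (Cremona label 388800ha1)] -/
theorem missingUpperBoundAt_g388800ha1_3_lp01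
    (hKatoA : Kato2004.rankZero_padicValNat_sha_add_padicValNat_tamagawa_le_of_additive_potGood_of_irreducible_of_fineSelmerDual_fg)
    (hGZK : rank_eq_analyticRank_of_analyticRank_le_one) (hmod : hasEntireLFunction_rat)
    (hLim : Lim2017.thm35_fineSelmerDual_moduleFinite_of_classicalMuVanishes_of_le_divisionField)
    (hF1 : fukuda1994_thm1_classNumberPExp_const_of_succ_eq)
    {W : WeierstrassCurve ℚ} [W.IsElliptic] [W.IsGloballyMinimal] (hWeq : W = (⟨0, 0, 0, (-4860), (-130410)⟩ : WeierstrassCurve ℚ))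
    (hr : W.analyticRank = 0) (P : W.geomTorsion (3 : ℕ))
    (hram : ∀ κ : ZpExtension ↥(W.unipotentStabilizerField 3 P) 3, κ.IsCyclotomic → TotallyRamifiedFrom κ 0)
    (hord : ∀ κ : ZpExtension ↥(W.unipotentStabilizerField 3 P) 3, κ.IsCyclotomic →
      classNumberPExp κ (0 + 1) = classNumberPExp κ 0) :
    MissingUpperBoundAt W 3 := by
  subst hWeq
  haveI : Fact (Nat.Prime 3) := ⟨Nat.prime_three⟩
  exact UnitIndexMuDoors.missingUpperBoundAt_three_of_classNumberPExp_succ_eqAt_unipotentStabilizerField _ hKatoA hGZK hmod hLim hF1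
    hr classO6_g388800ha1_3 irr_g388800ha1_3 P 0 hram hord

/-! ### `388800hb1` @ `p = 3` — `N = 388800 = 2^6·3^5·5^2`; Cremona: `r_an = 0`; O6 wild at `3`; mod-`3` image `GL₂(𝔽₃)` (9-deficient tower; NO Cartan road); first road: the unit-twist record
`missingUpperBoundAt_g388800hb1_3` (k9-c4 g16/g17); kernel lemmas in `…WildUpperUnitTwistRecordsClassO617` (`classO6`) / `…WildUpperUnitTwistRecordsFlat54` (`irr`, `isElliptic`, `isGloballyMinimal`).  conjA-anchor g9 kit j296187
(`lp16.gp`): `k = ℚ(x(P)) = ℚ[x]/(x^4-6*x^2-2*x+6)` (`h = 1`), `K = ℚ(P) = ℚ[x]/(x^8-4*x^7-16*x^6-12*x^5+1020*x^4-3912*x^3+3426*x^2+6564*x-10446)` (`h = 2`), `L_P = ℚ(P, ζ₃) = ℚ[x]/(x^16-8*x^15+36*x^14-112*x^13+416*x^12-2304*x^11+5484*x^10-5916*x^9+50082*x^8-168416*x^7+115984*x^6-476304*x^5+2558916*x^4-2999112*x^3+2613036*x^2-10123208*x+10719076)` (degree 16): `h(L_P) = 2`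
(`Cl ≅ [2]`, CERTIFIED), primes above `3`: `2[[6,2],[2,2]]`; octic leaves `O1:h=2:CERT;O2:h=2:CERT;O3:h=1:CERT;O1,1:h=2:GRH;O2,1:h=2:GRH;O3,1:h=1:GRH`; `layer0; #octics>k 3 of 3 octic subfields; v3h(L_P)+2v3h(k) 0; sum v3h(O_i) 0; KURODA-OK; octics certified 1; k cert CERT`; layer `(0,1)`: TOTRAM, `e₀(L_P) = 0`, `e₁(L_P) = 0` (Kuroda, GRH),
`r₀ = 0`, `r₁ = 0` ⟹ verdict FUKUDA1-LP(0,1). -/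

/-- **(A) AT `(388800hb1, 3)` with the `μ`-hypothesis DISCHARGED by FUKUDA Thm. 1 (1) at layers `(0,1)` on `L_P = ℚ(E[3])^{U_P}`** (modulo the named facts
Lim 2017 Thm. 3.5 `hLim` and Fukuda `hF1`): `P` any geometric `3`-torsion point, displayed numerics on `L_P`: Fukuda index `0` (`hram`, exact: kit j296187 TOTRAM) and
`e₁(L_P) = e₀(L_P) = 0` (`hord`; `h(L_P) = 2` CERTIFIED, `e₁` by Kuroda from three degree-24 octic layers under GRH, kit j296187). CONDITIONAL; nothing booked;
(A)/BSD proved for no curve. [cite: Lim2017FineSelmer, §3 Thm. 3.5 and Lemma 3.2 (arXiv:1306.2047 pp. 6–7)] [cite: Fukuda1994, Thm. 1 (1), p. 264] [cite: Cremona2006, Table 1 (Cremona label 388800hb1)] -/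
theorem conjA_g388800hb1_3_lp01
    (hLim : Lim2017.thm35_fineSelmerDual_moduleFinite_of_classicalMuVanishes_of_le_divisionField)
    (hF1 : fukuda1994_thm1_classNumberPExp_const_of_succ_eq)
    {W : WeierstrassCurve ℚ} [W.IsElliptic] (hWeq : W = (⟨0, 0, 0, (-24300), 1134000⟩ : WeierstrassCurve ℚ)) (P : W.geomTorsion (3 : ℕ))
    (hram : ∀ κ : ZpExtension ↥(W.unipotentStabilizerField 3 P) 3, κ.IsCyclotomic → TotallyRamifiedFrom κ 0)
    (hord : ∀ κ : ZpExtension ↥(W.unipotentStabilizerField 3 P) 3, κ.IsCyclotomic →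
      classNumberPExp κ (0 + 1) = classNumberPExp κ 0)
    (κ : ZpExtension ℚ 3) (hκ : κ.IsCyclotomic) :
    ∃ (γ : absoluteGaloisGroup ℚ) (Df : W.FineSelmerDualData κ γ),
      Module.Finite ℤ_[3] (RestrictScalars ℤ_[3] (IwasawaAlgebra 3) Df.X) := by
  subst hWeq
  haveI : Fact (Nat.Prime 3) := ⟨Nat.prime_three⟩
  exact Lim2017.fineSelmerDual_moduleFinite_of_classNumberPExp_succ_eq_unipotentStabilizerField hF1 hLim _ 3 (by decide) 0 P hram hord κ hκ

/-- **RECORD (second road) — U₀ `ord₃ #Ш(E) ≤ ord₃ #Ш_an(E)` for `E = 388800hb1` with the `μ`-hypothesis DISCHARGED by FUKUDA Thm. 1 (1) at layers `(0,1)` on `L_P`**: named facts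
{A161-fine `hKatoA`, GZK `hGZK`, modularity `hmod`, `hLim`, `hF1`}, Cremona's `r_an = 0` (`hr`), a `3`-torsion point `P` and the displayed numerics `hram` / `hord` of
`L_P = ℚ(E[3])^{U_P}` (evidence: conjA-anchor g9 kit j296187; GRH through the degree-24 octic layers only). KERNEL: `E` elliptic, minimal, `ClassO6 E 3`, `E[3]` irreducible.
Per row; nothing booked; BSD proved for no curve. [cite: Kato2004Asterisque, Thm. 14.5 (3) (p. 236)] [cite: Lim2017FineSelmer, §3 Thm. 3.5 and Lemma 3.2 (arXiv:1306.2047 pp. 6–7)]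
[cite: Fukuda1994, Thm. 1 (1), p. 264] [cite: Cremona2006, Table 1 (Cremona label 388800hb1)] -/
theorem missingUpperBoundAt_g388800hb1_3_lp01
    (hKatoA : Kato2004.rankZero_padicValNat_sha_add_padicValNat_tamagawa_le_of_additive_potGood_of_irreducible_of_fineSelmerDual_fg)
    (hGZK : rank_eq_analyticRank_of_analyticRank_le_one) (hmod : hasEntireLFunction_rat)
    (hLim : Lim2017.thm35_fineSelmerDual_moduleFinite_of_classicalMuVanishes_of_le_divisionField)
    (hF1 : fukuda1994_thm1_classNumberPExp_const_of_succ_eq)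
    {W : WeierstrassCurve ℚ} [W.IsElliptic] [W.IsGloballyMinimal] (hWeq : W = (⟨0, 0, 0, (-24300), 1134000⟩ : WeierstrassCurve ℚ))
    (hr : W.analyticRank = 0) (P : W.geomTorsion (3 : ℕ))
    (hram : ∀ κ : ZpExtension ↥(W.unipotentStabilizerField 3 P) 3, κ.IsCyclotomic → TotallyRamifiedFrom κ 0)
    (hord : ∀ κ : ZpExtension ↥(W.unipotentStabilizerField 3 P) 3, κ.IsCyclotomic →
      classNumberPExp κ (0 + 1) = classNumberPExp κ 0) :
    MissingUpperBoundAt W 3 := by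
  subst hWeq
  haveI : Fact (Nat.Prime 3) := ⟨Nat.prime_three⟩
  exact UnitIndexMuDoors.missingUpperBoundAt_three_of_classNumberPExp_succ_eqAt_unipotentStabilizerField _ hKatoA hGZK hmod hLim hF1
    hr classO6_g388800hb1_3 irr_g388800hb1_3 P 0 hram hord

/-! ### `388800hc1` @ `p = 3` — `N = 388800 = 2^6·3^5·5^2`; Cremona: `r_an = 0`; O6 wild at `3`; mod-`3` image `GL₂(𝔽₃)` (9-deficient tower; NO Cartan road); first road: the unit-twist record
`missingUpperBoundAt_g388800hc1_3` (k9-c4 g16/g17); kernel lemmas in `…WildUpperUnitTwistRecordsClassO617` (`classO6`) / `…WildUpperUnitTwistRecordsFlat46` (`irr`, `isElliptic`, `isGloballyMinimal`).  conjA-anchor g9 kit j296187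
(`lp16.gp`): `k = ℚ(x(P)) = ℚ[x]/(x^4-6*x^2-7*x-3)` (`h = 1`), `K = ℚ(P) = ℚ[x]/(x^8-2*x^7+x^6+68*x^5+260*x^4+1442*x^3+5426*x^2+8252*x+3761)` (`h = 4`), `L_P = ℚ(P, ζ₃) = ℚ[x]/(x^16-2*x^15-7*x^14-158*x^13+27*x^12+1810*x^11+1390*x^10+11996*x^9+56079*x^8+85994*x^7+206210*x^6+530440*x^5+773042*x^4+1133748*x^3+1597778*x^2+2064452*x+1874161)` (degree 16): `h(L_P) = 8`
(`Cl ≅ [4, 2]`, CERTIFIED), primes above `3`: `2[[2,2],[6,2]]`; octic leaves `O1:h=4:CERT;O2:h=4:CERT;O3:h=2:CERT;O1,1:h=4:GRH;O2,1:h=4:GRH;O3,1:h=2:GRH`; `layer0; #octics>k 3 of 3 octic subfields; v3h(L_P)+2v3h(k) 0; sum v3h(O_i) 0; KURODA-OK; octics certified 1; k cert CERT`; layer `(0,1)`: TOTRAM, `e₀(L_P) = 0`, `e₁(L_P) = 0` (Kuroda, GRH),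
`r₀ = 0`, `r₁ = 0` ⟹ verdict FUKUDA1-LP(0,1). -/

/-- **(A) AT `(388800hc1, 3)` with the `μ`-hypothesis DISCHARGED by FUKUDA Thm. 1 (1) at layers `(0,1)` on `L_P = ℚ(E[3])^{U_P}`** (modulo the named facts
Lim 2017 Thm. 3.5 `hLim` and Fukuda `hF1`): `P` any geometric `3`-torsion point, displayed numerics on `L_P`: Fukuda index `0` (`hram`, exact: kit j296187 TOTRAM) and
`e₁(L_P) = e₀(L_P) = 0` (`hord`; `h(L_P) = 8` CERTIFIED, `e₁` by Kuroda from three degree-24 octic layers under GRH, kit j296187). CONDITIONAL; nothing booked;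
(A)/BSD proved for no curve. [cite: Lim2017FineSelmer, §3 Thm. 3.5 and Lemma 3.2 (arXiv:1306.2047 pp. 6–7)] [cite: Fukuda1994, Thm. 1 (1), p. 264] [cite: Cremona2006, Table 1 (Cremona label 388800hc1)] -/
theorem conjA_g388800hc1_3_lp01
    (hLim : Lim2017.thm35_fineSelmerDual_moduleFinite_of_classicalMuVanishes_of_le_divisionField)
    (hF1 : fukuda1994_thm1_classNumberPExp_const_of_succ_eq)
    {W : WeierstrassCurve ℚ} [W.IsElliptic] (hWeq : W = (⟨0, 0, 0, (-540), (-4830)⟩ : WeierstrassCurve ℚ)) (P : W.geomTorsion (3 : ℕ))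
    (hram : ∀ κ : ZpExtension ↥(W.unipotentStabilizerField 3 P) 3, κ.IsCyclotomic → TotallyRamifiedFrom κ 0)
    (hord : ∀ κ : ZpExtension ↥(W.unipotentStabilizerField 3 P) 3, κ.IsCyclotomic →
      classNumberPExp κ (0 + 1) = classNumberPExp κ 0)
    (κ : ZpExtension ℚ 3) (hκ : κ.IsCyclotomic) :
    ∃ (γ : absoluteGaloisGroup ℚ) (Df : W.FineSelmerDualData κ γ),
      Module.Finite ℤ_[3] (RestrictScalars ℤ_[3] (IwasawaAlgebra 3) Df.X) := by
  subst hWeq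
  haveI : Fact (Nat.Prime 3) := ⟨Nat.prime_three⟩
  exact Lim2017.fineSelmerDual_moduleFinite_of_classNumberPExp_succ_eq_unipotentStabilizerField hF1 hLim _ 3 (by decide) 0 P hram hord κ hκ

/-- **RECORD (second road) — U₀ `ord₃ #Ш(E) ≤ ord₃ #Ш_an(E)` for `E = 388800hc1` with the `μ`-hypothesis DISCHARGED by FUKUDA Thm. 1 (1) at layers `(0,1)` on `L_P`**: named facts
{A161-fine `hKatoA`, GZK `hGZK`, modularity `hmod`, `hLim`, `hF1`}, Cremona's `r_an = 0` (`hr`), a `3`-torsion point `P` and the displayed numerics `hram` / `hord` of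
`L_P = ℚ(E[3])^{U_P}` (evidence: conjA-anchor g9 kit j296187; GRH through the degree-24 octic layers only). KERNEL: `E` elliptic, minimal, `ClassO6 E 3`, `E[3]` irreducible.
Per row; nothing booked; BSD proved for no curve. [cite: Kato2004Asterisque, Thm. 14.5 (3) (p. 236)] [cite: Lim2017FineSelmer, §3 Thm. 3.5 and Lemma 3.2 (arXiv:1306.2047 pp. 6–7)]
[cite: Fukuda1994, Thm. 1 (1), p. 264] [cite: Cremona2006, Table 1 (Cremona label 388800hc1)] -/
theorem missingUpperBoundAt_g388800hc1_3_lp01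
    (hKatoA : Kato2004.rankZero_padicValNat_sha_add_padicValNat_tamagawa_le_of_additive_potGood_of_irreducible_of_fineSelmerDual_fg)
    (hGZK : rank_eq_analyticRank_of_analyticRank_le_one) (hmod : hasEntireLFunction_rat)
    (hLim : Lim2017.thm35_fineSelmerDual_moduleFinite_of_classicalMuVanishes_of_le_divisionField)
    (hF1 : fukuda1994_thm1_classNumberPExp_const_of_succ_eq)
    {W : WeierstrassCurve ℚ} [W.IsElliptic] [W.IsGloballyMinimal] (hWeq : W = (⟨0, 0, 0, (-540), (-4830)⟩ : WeierstrassCurve ℚ))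
    (hr : W.analyticRank = 0) (P : W.geomTorsion (3 : ℕ))
    (hram : ∀ κ : ZpExtension ↥(W.unipotentStabilizerField 3 P) 3, κ.IsCyclotomic → TotallyRamifiedFrom κ 0)
    (hord : ∀ κ : ZpExtension ↥(W.unipotentStabilizerField 3 P) 3, κ.IsCyclotomic →
      classNumberPExp κ (0 + 1) = classNumberPExp κ 0) :
    MissingUpperBoundAt W 3 := by
  subst hWeq
  haveI : Fact (Nat.Prime 3) := ⟨Nat.prime_three⟩
  exact UnitIndexMuDoors.missingUpperBoundAt_three_of_classNumberPExp_succ_eqAt_unipotentStabilizerField _ hKatoA hGZK hmod hLim hF1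
    hr classO6_g388800hc1_3 irr_g388800hc1_3 P 0 hram hord

/-! ### `388800hp1` @ `p = 3` — `N = 388800 = 2^6·3^5·5^2`; Cremona: `r_an = 0`; O6 wild at `3`; mod-`3` image `GL₂(𝔽₃)` (9-deficient tower; NO Cartan road); first road: the unit-twist record
`missingUpperBoundAt_g388800hp1_3` (k9-c4 g16/g17); kernel lemmas in `…WildUpperUnitTwistRecordsClassO617` (`classO6`) / `…WildUpperUnitTwistRecordsFlat47` (`irr`, `isElliptic`, `isGloballyMinimal`).  conjA-anchor g9 kit j296187
(`lp16.gp`): `k = ℚ(x(P)) = ℚ[x]/(x^4-6*x^2-7*x-3)` (`h = 1`), `K = ℚ(P) = ℚ[x]/(x^8-20*x^6-36*x^4-48*x^2-48)` (`h = 1`), `L_P = ℚ(P, ζ₃) = ℚ[x]/(x^16-8*x^15+36*x^14-112*x^13+290*x^12-792*x^11+1824*x^10-3240*x^9+6099*x^8-10808*x^7+13600*x^6-18168*x^5+27426*x^4-24240*x^3+18156*x^2-25400*x+16129)` (degree 16): `h(L_P) = 2`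
(`Cl ≅ [2]`, CERTIFIED), primes above `3`: `2[[2,2],[6,2]]`; octic leaves `O1:h=1:CERT;O2:h=1:CERT;O3:h=2:CERT;O1,1:h=1:GRH;O2,1:h=1:GRH;O3,1:h=2:GRH`; `layer0; #octics>k 3 of 3 octic subfields; v3h(L_P)+2v3h(k) 0; sum v3h(O_i) 0; KURODA-OK; octics certified 1; k cert CERT`; layer `(0,1)`: TOTRAM, `e₀(L_P) = 0`, `e₁(L_P) = 0` (Kuroda, GRH),
`r₀ = 0`, `r₁ = 0` ⟹ verdict FUKUDA1-LP(0,1). -/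

/-- **(A) AT `(388800hp1, 3)` with the `μ`-hypothesis DISCHARGED by FUKUDA Thm. 1 (1) at layers `(0,1)` on `L_P = ℚ(E[3])^{U_P}`** (modulo the named facts
Lim 2017 Thm. 3.5 `hLim` and Fukuda `hF1`): `P` any geometric `3`-torsion point, displayed numerics on `L_P`: Fukuda index `0` (`hram`, exact: kit j296187 TOTRAM) and
`e₁(L_P) = e₀(L_P) = 0` (`hord`; `h(L_P) = 2` CERTIFIED, `e₁` by Kuroda from three degree-24 octic layers under GRH, kit j296187). CONDITIONAL; nothing booked;
(A)/BSD proved for no curve. [cite: Lim2017FineSelmer, §3 Thm. 3.5 and Lemma 3.2 (arXiv:1306.2047 pp. 6–7)] [cite: Fukuda1994, Thm. 1 (1), p. 264] [cite: Cremona2006, Table 1 (Cremona label 388800hp1)] -/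
theorem conjA_g388800hp1_3_lp01
    (hLim : Lim2017.thm35_fineSelmerDual_moduleFinite_of_classicalMuVanishes_of_le_divisionField)
    (hF1 : fukuda1994_thm1_classNumberPExp_const_of_succ_eq)
    {W : WeierstrassCurve ℚ} [W.IsElliptic] (hWeq : W = (⟨0, 0, 0, (-121500), (-16301250)⟩ : WeierstrassCurve ℚ)) (P : W.geomTorsion (3 : ℕ))
    (hram : ∀ κ : ZpExtension ↥(W.unipotentStabilizerField 3 P) 3, κ.IsCyclotomic → TotallyRamifiedFrom κ 0)
    (hord : ∀ κ : ZpExtension ↥(W.unipotentStabilizerField 3 P) 3, κ.IsCyclotomic →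
      classNumberPExp κ (0 + 1) = classNumberPExp κ 0)
    (κ : ZpExtension ℚ 3) (hκ : κ.IsCyclotomic) :
    ∃ (γ : absoluteGaloisGroup ℚ) (Df : W.FineSelmerDualData κ γ),
      Module.Finite ℤ_[3] (RestrictScalars ℤ_[3] (IwasawaAlgebra 3) Df.X) := by
  subst hWeq
  haveI : Fact (Nat.Prime 3) := ⟨Nat.prime_three⟩
  exact Lim2017.fineSelmerDual_moduleFinite_of_classNumberPExp_succ_eq_unipotentStabilizerField hF1 hLim _ 3 (by decide) 0 P hram hord κ hκ

/-- **RECORD (second road) — U₀ `ord₃ #Ш(E) ≤ ord₃ #Ш_an(E)` for `E = 388800hp1` with the `μ`-hypothesis DISCHARGED by FUKUDA Thm. 1 (1) at layers `(0,1)` on `L_P`**: named facts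
{A161-fine `hKatoA`, GZK `hGZK`, modularity `hmod`, `hLim`, `hF1`}, Cremona's `r_an = 0` (`hr`), a `3`-torsion point `P` and the displayed numerics `hram` / `hord` of
`L_P = ℚ(E[3])^{U_P}` (evidence: conjA-anchor g9 kit j296187; GRH through the degree-24 octic layers only). KERNEL: `E` elliptic, minimal, `ClassO6 E 3`, `E[3]` irreducible.
Per row; nothing booked; BSD proved for no curve. [cite: Kato2004Asterisque, Thm. 14.5 (3) (p. 236)] [cite: Lim2017FineSelmer, §3 Thm. 3.5 and Lemma 3.2 (arXiv:1306.2047 pp. 6–7)]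
[cite: Fukuda1994, Thm. 1 (1), p. 264] [cite: Cremona2006, Table 1 (Cremona label 388800hp1)] -/
theorem missingUpperBoundAt_g388800hp1_3_lp01
    (hKatoA : Kato2004.rankZero_padicValNat_sha_add_padicValNat_tamagawa_le_of_additive_potGood_of_irreducible_of_fineSelmerDual_fg)
    (hGZK : rank_eq_analyticRank_of_analyticRank_le_one) (hmod : hasEntireLFunction_rat)
    (hLim : Lim2017.thm35_fineSelmerDual_moduleFinite_of_classicalMuVanishes_of_le_divisionField)
    (hF1 : fukuda1994_thm1_classNumberPExp_const_of_succ_eq)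
    {W : WeierstrassCurve ℚ} [W.IsElliptic] [W.IsGloballyMinimal] (hWeq : W = (⟨0, 0, 0, (-121500), (-16301250)⟩ : WeierstrassCurve ℚ))
    (hr : W.analyticRank = 0) (P : W.geomTorsion (3 : ℕ))
    (hram : ∀ κ : ZpExtension ↥(W.unipotentStabilizerField 3 P) 3, κ.IsCyclotomic → TotallyRamifiedFrom κ 0)
    (hord : ∀ κ : ZpExtension ↥(W.unipotentStabilizerField 3 P) 3, κ.IsCyclotomic →
      classNumberPExp κ (0 + 1) = classNumberPExp κ 0) :
    MissingUpperBoundAt W 3 := by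
  subst hWeq
  haveI : Fact (Nat.Prime 3) := ⟨Nat.prime_three⟩
  exact UnitIndexMuDoors.missingUpperBoundAt_three_of_classNumberPExp_succ_eqAt_unipotentStabilizerField _ hKatoA hGZK hmod hLim hF1
    hr classO6_g388800hp1_3 irr_g388800hp1_3 P 0 hram hord

/-! ### `388800hv1` @ `p = 3` — `N = 388800 = 2^6·3^5·5^2`; Cremona: `r_an = 0`; O6 wild at `3`; mod-`3` image `GL₂(𝔽₃)` (9-deficient tower; NO Cartan road); first road: the unit-twist record
`missingUpperBoundAt_g388800hv1_3` (k9-c4 g16/g17); kernel lemmas in `…WildUpperUnitTwistRecordsClassO618` (`classO6`) / `…WildUpperUnitTwistRecordsFlat65` (`irr`, `isElliptic`, `isGloballyMinimal`).  conjA-anchor g9 kit j296187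
(`lp16.gp`): `k = ℚ(x(P)) = ℚ[x]/(x^4-6*x^2-7*x-3)` (`h = 1`), `K = ℚ(P) = ℚ[x]/(x^8-360*x^4-3720*x^2-10800)` (`h = 4`), `L_P = ℚ(P, ζ₃) = ℚ[x]/(x^16-120*x^12+1040*x^10+15600*x^8+81600*x^6+894400*x^4+2064000*x^2+1440000)` (degree 16): `h(L_P) = 8`
(`Cl ≅ [4, 2]`, CERTIFIED), primes above `3`: `2[[2,2],[6,2]]`; octic leaves `O1:h=4:CERT;O2:h=4:CERT;O3:h=2:CERT;O1,1:h=4:GRH;O2,1:h=4:GRH;O3,1:h=2:GRH`; `layer0; #octics>k 3 of 3 octic subfields; v3h(L_P)+2v3h(k) 0; sum v3h(O_i) 0; KURODA-OK; octics certified 1; k cert CERT`; layer `(0,1)`: TOTRAM, `e₀(L_P) = 0`, `e₁(L_P) = 0` (Kuroda, GRH),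
`r₀ = 0`, `r₁ = 0` ⟹ verdict FUKUDA1-LP(0,1). -/

/-- **(A) AT `(388800hv1, 3)` with the `μ`-hypothesis DISCHARGED by FUKUDA Thm. 1 (1) at layers `(0,1)` on `L_P = ℚ(E[3])^{U_P}`** (modulo the named facts
Lim 2017 Thm. 3.5 `hLim` and Fukuda `hF1`): `P` any geometric `3`-torsion point, displayed numerics on `L_P`: Fukuda index `0` (`hram`, exact: kit j296187 TOTRAM) and
`e₁(L_P) = e₀(L_P) = 0` (`hord`; `h(L_P) = 8` CERTIFIED, `e₁` by Kuroda from three degree-24 octic layers under GRH, kit j296187). CONDITIONAL; nothing booked;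
(A)/BSD proved for no curve. [cite: Lim2017FineSelmer, §3 Thm. 3.5 and Lemma 3.2 (arXiv:1306.2047 pp. 6–7)] [cite: Fukuda1994, Thm. 1 (1), p. 264] [cite: Cremona2006, Table 1 (Cremona label 388800hv1)] -/
theorem conjA_g388800hv1_3_lp01
    (hLim : Lim2017.thm35_fineSelmerDual_moduleFinite_of_classicalMuVanishes_of_le_divisionField)
    (hF1 : fukuda1994_thm1_classNumberPExp_const_of_succ_eq)
    {W : WeierstrassCurve ℚ} [W.IsElliptic] (hWeq : W = (⟨0, 0, 0, (-4860), 130410⟩ : WeierstrassCurve ℚ)) (P : W.geomTorsion (3 : ℕ))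
    (hram : ∀ κ : ZpExtension ↥(W.unipotentStabilizerField 3 P) 3, κ.IsCyclotomic → TotallyRamifiedFrom κ 0)
    (hord : ∀ κ : ZpExtension ↥(W.unipotentStabilizerField 3 P) 3, κ.IsCyclotomic →
      classNumberPExp κ (0 + 1) = classNumberPExp κ 0)
    (κ : ZpExtension ℚ 3) (hκ : κ.IsCyclotomic) :
    ∃ (γ : absoluteGaloisGroup ℚ) (Df : W.FineSelmerDualData κ γ),
      Module.Finite ℤ_[3] (RestrictScalars ℤ_[3] (IwasawaAlgebra 3) Df.X) := by
  subst hWeq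
  haveI : Fact (Nat.Prime 3) := ⟨Nat.prime_three⟩
  exact Lim2017.fineSelmerDual_moduleFinite_of_classNumberPExp_succ_eq_unipotentStabilizerField hF1 hLim _ 3 (by decide) 0 P hram hord κ hκ

/-- **RECORD (second road) — U₀ `ord₃ #Ш(E) ≤ ord₃ #Ш_an(E)` for `E = 388800hv1` with the `μ`-hypothesis DISCHARGED by FUKUDA Thm. 1 (1) at layers `(0,1)` on `L_P`**: named facts
{A161-fine `hKatoA`, GZK `hGZK`, modularity `hmod`, `hLim`, `hF1`}, Cremona's `r_an = 0` (`hr`), a `3`-torsion point `P` and the displayed numerics `hram` / `hord` of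
`L_P = ℚ(E[3])^{U_P}` (evidence: conjA-anchor g9 kit j296187; GRH through the degree-24 octic layers only). KERNEL: `E` elliptic, minimal, `ClassO6 E 3`, `E[3]` irreducible.
Per row; nothing booked; BSD proved for no curve. [cite: Kato2004Asterisque, Thm. 14.5 (3) (p. 236)] [cite: Lim2017FineSelmer, §3 Thm. 3.5 and Lemma 3.2 (arXiv:1306.2047 pp. 6–7)]
[cite: Fukuda1994, Thm. 1 (1), p. 264] [cite: Cremona2006, Table 1 (Cremona label 388800hv1)] -/
theorem missingUpperBoundAt_g388800hv1_3_lp01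
    (hKatoA : Kato2004.rankZero_padicValNat_sha_add_padicValNat_tamagawa_le_of_additive_potGood_of_irreducible_of_fineSelmerDual_fg)
    (hGZK : rank_eq_analyticRank_of_analyticRank_le_one) (hmod : hasEntireLFunction_rat)
    (hLim : Lim2017.thm35_fineSelmerDual_moduleFinite_of_classicalMuVanishes_of_le_divisionField)
    (hF1 : fukuda1994_thm1_classNumberPExp_const_of_succ_eq)
    {W : WeierstrassCurve ℚ} [W.IsElliptic] [W.IsGloballyMinimal] (hWeq : W = (⟨0, 0, 0, (-4860), 130410⟩ : WeierstrassCurve ℚ))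
    (hr : W.analyticRank = 0) (P : W.geomTorsion (3 : ℕ))
    (hram : ∀ κ : ZpExtension ↥(W.unipotentStabilizerField 3 P) 3, κ.IsCyclotomic → TotallyRamifiedFrom κ 0)
    (hord : ∀ κ : ZpExtension ↥(W.unipotentStabilizerField 3 P) 3, κ.IsCyclotomic →
      classNumberPExp κ (0 + 1) = classNumberPExp κ 0) :
    MissingUpperBoundAt W 3 := by
  subst hWeq
  haveI : Fact (Nat.Prime 3) := ⟨Nat.prime_three⟩
  exact UnitIndexMuDoors.missingUpperBoundAt_three_of_classNumberPExp_succ_eqAt_unipotentStabilizerField _ hKatoA hGZK hmod hLim hF1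
    hr classO6_g388800hv1_3 irr_g388800hv1_3 P 0 hram hord

end Summit.BirchSwinnertonDyer.BirchSwinnertonDyer.Theorems.WildUpperUnitTwistRecords

end
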